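import Literature.NumberTheory.Automorphic.GKInfinitesimallyUnitary
import Literature.NumberTheory.Automorphic.GKModulesInvariantBilinForm
import HarnessLib

/-!
# The six clauses imply Borel–Wallach unitarity: `IsInfUnitaryAlongP ⇒ Liu2021.LemD2.IsInfUnitary` for `U(2,1)`

Topic `NumberTheory/Automorphic`; namespace `Literature.NumberTheory.Automorphic`.  THEOREMS ONLY (no definition, no
instance, no notation, no named fact, no `sorry`).  Sequel of ★ `GKInfinitesimallyUnitary` (the six-clause predicate
`IsInfUnitaryAlongP ρ𝔤` of a `(𝔤, K)`-module of `U(α, β)` and the PROVED direction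
`isInfUnitaryAlongP_of_isInfUnitary : Liu2021.LemD2.IsInfUnitary ρK ρ𝔤 → IsInfUnitaryAlongP ρ𝔤`) and of ★
`GKModulesInvariantBilinForm` (`𝔨`-skew real forms are `K`-invariant; the Hermitian form of a compatible real form).  This file
proves the CONVERSE for `U(2,1)` — the «folklore bracket-closure argument NOT proved» of that header — so that for every
`(𝔤, K)`-module of `U(2,1)` the two notions coincide (`isInfUnitary_iff_isInfUnitaryAlongP`), and records it in the shape
the floor's archimedean line `Cruxes/H413/Lines/F0_T1a_ArchCharactersLinIndep.lean` consumes (sub-goal (α) «six-clause bridge»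
of `stub_archAssembly`): **`sixClauses_holds`**.

THE ARGUMENT (Borel–Wallach 0 §2.5 read backwards).  Let `B` be the real symmetric positive-definite form of the six clauses,
skew for the `𝔭`-frame `(x_s)` (★ `upqPBasis`) and for `z₀` (★ `upqZ0`), with `B(ia, b) = −B(a, ib)`.
1. (§3) **`𝔲(2,1)` is generated by the `𝔭`-frame and `z₀`** (`upq21_lieSubalgebra_eq_top`): a Lie subalgebra containing
   them contains all `X_{cE_p}` (★ `upqUnit`), their brackets `[X_{cE_a}, X_{c′E_{a′}}]` (explicit block-diagonal matrices,
   `coe_lie_upqUnit_upqUnit`) and `z₀ = diag(i, i, 0)`; these span `𝔨 = 𝔲(2) ⊕ 𝔲(1)` over `ℝ` (`[𝔭, 𝔭] = 𝔰(𝔲(2) ⊕ 𝔲(1))`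
   has codimension one in `𝔨`, and `tr z₀ = 2i ≠ 0`), and `𝔤 = 𝔨 + Σ_s ℝ x_s` (★ `upq_exists_kInLie_add_sum_upqPBasis`).
2. (§4) **All of `𝔤` is `B`-skew** (`upq21_skew_of_frame`): the `B`-skew elements form a Lie subalgebra (`ρ𝔤` is a Lie
   morphism and a commutator of `B`-skew operators is `B`-skew), which contains the frame and `z₀`.
3. (§5) Hence `K = exp 𝔨` is `B`-orthogonal (★ `upq_bilin_apply_eq_of_skew`) and `H = B + iB(i·, ·)` is the printed Hermitian
   form (★ `isInfUnitary_of_bilinForm`): `isInfUnitary_of_isInfUnitaryAlongP`, `isInfUnitary_iff_isInfUnitaryAlongP`,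
   **`sixClauses_holds`**.
Admissibility and irreducibility play no role: the converse holds for EVERY `(𝔤, K)`-module of `U(2,1)`; the binder
`IsAdmissibleGK r.ρK` of `sixClauses_holds` is the consumer's text (typ-T1a (g0), 2026-08-31) and is idle.

## Mathlib / Literature search

Tree: ★ `upqUnit` ∕ `coe_upqUnit` ∕ `upq_real_smul_upqUnit` ∕ `upqUnit_add` (`UpqLefschetzDecomposition`, `UpqHodgeBigrading`),
★ `upqPBasis` ∕ `upqPCoeff` ∕ `upq_exists_kInLie_add_sum_upqPBasis` (`UpqCasimirTensor`), ★ `upq_mem_kInLie_iff_blocks` ∕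
`upq_lie_blocks` (`TrivialModuleGKCohomologyUnitary`), ★ `coe_upqZ0` (`UpqHodgeBigrading`), ★ `IsInfUnitaryAlongP` ∕
`isInfUnitaryAlongP_of_isInfUnitary` (`GKInfinitesimallyUnitary`), ★ `upq_bilin_apply_eq_of_skew` ∕ `isInfUnitary_of_bilinForm`
(`GKModulesInvariantBilinForm`).  Mathlib: `Matrix.conjTranspose_single`, `Matrix.single_mul_single_same` ∕ `_of_ne`,
`Matrix.fromBlocks_multiply`, `LieSubalgebra.mem_top`.  Dedup: `rg "sixClauses|upq21_|coe_lie_upqUnit_upqUnit|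
isInfUnitary_of_isInfUnitaryAlongP"` over `Literature/`, `Summits/` — no hits (the tree's `upqUnit_eq_re_smul_add_im_smul` is
the `U(1,1)`-specific statement of `U11HolomorphicDiscreteSeries`; the general one here is `upqUnit_eq_re_smul_one_add_im_smul_I`).

## References

* A. Borel, N. Wallach, *Continuous Cohomology, Discrete Subgroups, and Representations of Reductive Groups*, 2nd ed., AMS
  (2000), Ch. 0 §2.5 p. 4 (unitary `(𝔤, K)`-modules), II §1.1 (3)–(5) (`𝔤 = 𝔨 ⊕ 𝔭`, the `𝔭`-frame), II §4.1 (`z₀`).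
  [BorelWallach2000]
* A. W. Knapp, *Lie Groups Beyond an Introduction*, 2nd ed., Birkhäuser (2002), I §1 Example (3) (`𝔲(p,q)`,
  `𝔨 = 𝔲(p) ⊕ 𝔲(q)`). [Knapp2002]
* A. W. Knapp, D. A. Vogan, *Cohomological Induction and Unitary Representations*, Princeton (1995), §I.4. [KnappVogan1995]
-/

-- Mathlib idiom (Mathlib/Algebra/Lie/OfAssociative.lean), as in ★ `GKModules` ∕ ★ `GKInfinitesimallyUnitary`:
-- the associative algebras `Matrix n n ℂ` and `Module.End ℂ V` as Lie rings (commutator bracket).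
attribute [local instance 100] LieRing.ofAssociativeRing

set_option autoImplicit false

noncomputable section

open scoped MatrixGroups Matrix ComplexConjugate

namespace Literature.NumberTheory.Automorphic

open Literature.RepresentationTheory Literature.RepresentationTheory.BorelWallach2000
open Literature.RepresentationTheory.KonnoKonno2007

section Upq

variable {α β : Type*} [Fintype α] [DecidableEq α] [Fintype β] [DecidableEq β]

/-- A complex number with `conj z = −z` is `(Im z)·i`. [folklore] -/
private theorem eq_im_mul_I_of_star_eq_neg {z : ℂ} (h : star z = -z) : z = (z.im : ℂ) * Complex.I := by
  have hre : z.re = 0 := by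
    have := congrArg Complex.re h
    rw [Complex.star_def, Complex.conj_re, Complex.neg_re] at this
    linarith
  apply Complex.ext <;> simp [hre]

/-! ## §3 A Lie subalgebra of `𝔲(2,1)` containing the `𝔭`-frame and `z₀` is everything -/

/-- **The bracket of two `𝔭`-generators**, as a block-diagonal matrix:
`[X_{cE_{ab}}, X_{c′E_{a′b′}}] = diag(S T† − T S†, S† T − T† S)` with `S = c E_{ab}`, `T = c′ E_{a′b′}`.
[cite: BorelWallach2000, II §1.1 (4)] -/
theorem coe_lie_upqUnit_upqUnit (a a' : α) (b b' : β) (c c' : ℂ) :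
    ((⁅upqUnit (a, b) c, upqUnit (a', b') c'⁆ : (uFormGroup α β).lie) : Matrix (α ⊕ β) (α ⊕ β) ℂ) =
      Matrix.fromBlocks
        (Matrix.single a b c * (Matrix.single a' b' c')ᴴ - Matrix.single a' b' c' * (Matrix.single a b c)ᴴ) 0 0
        ((Matrix.single a b c)ᴴ * Matrix.single a' b' c' - (Matrix.single a' b' c')ᴴ * Matrix.single a b c) := by
  rw [LieSubalgebra.coe_bracket, Ring.lie_def, coe_upqUnit, coe_upqUnit, Matrix.fromBlocks_multiply,
    Matrix.fromBlocks_multiply, sub_eq_add_neg, Matrix.fromBlocks_neg, Matrix.fromBlocks_add]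
  simp only [Matrix.zero_mul, Matrix.mul_zero, zero_add, add_zero, neg_zero, sub_eq_add_neg]

/-- `X_{cE_p} = (Re c)·X_{E_p} + (Im c)·X_{iE_p}`. [cite: BorelWallach2000, II §1.1 (5)] -/
theorem upqUnit_eq_re_smul_one_add_im_smul_I (p : α × β) (c : ℂ) :
    upqUnit p c = c.re • upqUnit p 1 + c.im • upqUnit p Complex.I := by
  rw [upq_real_smul_upqUnit, upq_real_smul_upqUnit, upqUnit_add, mul_one, Complex.re_add_im]

/-- A Lie subalgebra of `𝔲(α, β)` containing the `𝔭`-frame `(x_s)` contains every `X_{cE_p}`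
(`X_{E_p} = x_{(p,0)} + x_{(p,1)}`, `X_{iE_p} = x_{(p,0)} − x_{(p,1)}`). [cite: BorelWallach2000, II §1.1 (5)] -/
theorem upqUnit_mem_of_upqPBasis_mem (S : LieSubalgebra ℝ (uFormGroup α β).lie) (hP : ∀ s, upqPBasis s ∈ S)
    (p : α × β) (c : ℂ) : upqUnit p c ∈ S := by
  have h0 : upqPBasis (p, 0) = upqUnit p ((1 + Complex.I) / 2) := rfl
  have h1 : upqPBasis (p, 1) = upqUnit p ((1 - Complex.I) / 2) := rfl
  have hone : upqUnit p 1 ∈ S := by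
    have := S.add_mem (hP (p, 0)) (hP (p, 1))
    rw [h0, h1, upqUnit_add] at this
    convert this using 2
    ring
  have hI : upqUnit p Complex.I ∈ S := by
    have := S.sub_mem (hP (p, 0)) (hP (p, 1))
    rw [h0, h1, sub_eq_add_neg, ← neg_one_smul ℝ (upqUnit p ((1 - Complex.I) / 2)), upq_real_smul_upqUnit,
      upqUnit_add] at this
    convert this using 2
    push_cast
    ring
  rw [upqUnit_eq_re_smul_one_add_im_smul_I p c]
  exact S.add_mem (S.smul_mem _ hone) (S.smul_mem _ hI)

/-- **`𝔲(2,1)` is generated, as a Lie algebra, by the `𝔭`-frame and `z₀`**: a real Lie subalgebra `S` of `𝔲(2,1)`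
containing every `x_s` (★ `upqPBasis`) and `z₀ = diag(i, i, 0)` (★ `upqZ0`) is all of `𝔲(2,1)`.  Indeed `S ⊇ 𝔭`
(`upqUnit_mem_of_upqPBasis_mem`), and `𝔨 = 𝔲(2) ⊕ 𝔲(1) ⊆ S`: with `U_a(c) = X_{cE_{a0}}`, the brackets
`[U_0(1), U_1(1)] = (E_{01} − E_{10}) ⊕ 0`, `[U_0(i), U_1(1)] = i(E_{01} + E_{10}) ⊕ 0`,
`[U_a(i), U_a(1)] = 2iE_{aa} ⊕ (−2i)` and `z₀ = i1 ⊕ 0` span `𝔨` over `ℝ` (a skew-Hermitian `diag(A, d)` with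
`A_{01} = m`, `A_{aa} = iθ_a`, `d = iφ` is `Re m·[U_0(1),U_1(1)] + Im m·[U_0(i),U_1(1)] + Σ_a ½(θ_a − λ)[U_a(i),U_a(1)] + λ z₀`,
`λ = ½(θ_0 + θ_1 + φ)`); finally `𝔤 = 𝔨 + Σ_s ℝ x_s` (★ `upq_exists_kInLie_add_sum_upqPBasis`).
[cite: Knapp2002, I §1 Example (3)] [cite: BorelWallach2000, II §1.1 (3)–(5); II §4.1] -/
theorem upq21_lieSubalgebra_eq_top (S : LieSubalgebra ℝ (uFormGroup (Fin 2) (Fin 1)).lie)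
    (hP : ∀ s, upqPBasis s ∈ S) (hZ : upqZ0 (Fin 2) (Fin 1) ∈ S) : S = ⊤ := by
  have hU : ∀ (p : Fin 2 × Fin 1) (c : ℂ), upqUnit p c ∈ S := upqUnit_mem_of_upqPBasis_mem S hP
  have hbr : ∀ (a a' : Fin 2) (c c' : ℂ), ⁅upqUnit (a, (0 : Fin 1)) c, upqUnit (a', (0 : Fin 1)) c'⁆ ∈ S :=
    fun a a' c c' ↦ S.lie_mem (hU _ _) (hU _ _)
  -- the four bracket generators of `𝔨`, as matrices
  have hg : ∀ (c : ℂ), (((⁅upqUnit ((0 : Fin 2), (0 : Fin 1)) c, upqUnit ((1 : Fin 2), (0 : Fin 1)) 1⁆ :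
      (uFormGroup (Fin 2) (Fin 1)).lie)) : Matrix (Fin 2 ⊕ Fin 1) (Fin 2 ⊕ Fin 1) ℂ) =
        Matrix.fromBlocks (Matrix.single 0 1 c - Matrix.single 1 0 (star c)) 0 0 0 := by
    intro c
    rw [coe_lie_upqUnit_upqUnit, Matrix.conjTranspose_single, Matrix.conjTranspose_single, star_one,
      Matrix.single_mul_single_same, Matrix.single_mul_single_same, mul_one, one_mul,
      Matrix.single_mul_single_of_ne (h := (zero_ne_one : (0 : Fin 2) ≠ 1)),
      Matrix.single_mul_single_of_ne (h := (one_ne_zero : (1 : Fin 2) ≠ 0)), sub_zero]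
  have hd : ∀ (a : Fin 2), (((⁅upqUnit (a, (0 : Fin 1)) Complex.I, upqUnit (a, (0 : Fin 1)) 1⁆ :
      (uFormGroup (Fin 2) (Fin 1)).lie)) : Matrix (Fin 2 ⊕ Fin 1) (Fin 2 ⊕ Fin 1) ℂ) =
        Matrix.fromBlocks (Matrix.single a a Complex.I - Matrix.single a a (-Complex.I)) 0 0
          (Matrix.single 0 0 (-Complex.I) - Matrix.single 0 0 Complex.I) := by
    intro a
    rw [coe_lie_upqUnit_upqUnit, Matrix.conjTranspose_single, Matrix.conjTranspose_single, star_one,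
      Complex.star_def, Complex.conj_I, Matrix.single_mul_single_same, Matrix.single_mul_single_same,
      Matrix.single_mul_single_same, Matrix.single_mul_single_same, mul_one, one_mul, mul_one, one_mul]
  -- `𝔨 ⊆ S`
  have hk : ∀ k ∈ (uFormGroup (Fin 2) (Fin 1)).kInLie, k ∈ S := by
    intro k hk
    have h12 := (upq_mem_kInLie_iff_blocks k).1 hk
    obtain ⟨h11, h22, h21⟩ := upq_lie_blocks k
    rw [h12, Matrix.conjTranspose_zero] at h21
    set M : Matrix (Fin 2 ⊕ Fin 1) (Fin 2 ⊕ Fin 1) ℂ := (k : Matrix (Fin 2 ⊕ Fin 1) (Fin 2 ⊕ Fin 1) ℂ) with hM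
    -- the entries of `M`
    have e12 : ∀ (a : Fin 2) (b : Fin 1), M (Sum.inl a) (Sum.inr b) = 0 := fun a b ↦ by
      have := congrFun (congrFun h12 a) b
      exact this
    have e21 : ∀ (b : Fin 1) (a : Fin 2), M (Sum.inr b) (Sum.inl a) = 0 := fun b a ↦ by
      have := congrFun (congrFun h21 b) a
      exact this
    have e11 : ∀ (a a' : Fin 2), star (M (Sum.inl a') (Sum.inl a)) = -M (Sum.inl a) (Sum.inl a') := fun a a' ↦ by
      have := congrFun (congrFun h11 a) a'
      exact this
    have e22 : star (M (Sum.inr 0) (Sum.inr 0)) = -M (Sum.inr 0) (Sum.inr 0) := by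
      have := congrFun (congrFun h22 0) 0
      exact this
    -- real coordinates of `k`
    set m : ℂ := M (Sum.inl 0) (Sum.inl 1) with hm
    set θ₀ : ℝ := (M (Sum.inl 0) (Sum.inl 0)).im
    set θ₁ : ℝ := (M (Sum.inl 1) (Sum.inl 1)).im
    set φ : ℝ := (M (Sum.inr 0) (Sum.inr 0)).im
    set lam : ℝ := (θ₀ + θ₁ + φ) / 2 with hlam
    set t₀ : ℝ := (θ₀ - lam) / 2 with ht₀
    set t₁ : ℝ := (θ₁ - lam) / 2 with ht₁
    have d00 : M (Sum.inl 0) (Sum.inl 0) = (θ₀ : ℂ) * Complex.I := eq_im_mul_I_of_star_eq_neg (e11 0 0)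
    have d11 : M (Sum.inl 1) (Sum.inl 1) = (θ₁ : ℂ) * Complex.I := eq_im_mul_I_of_star_eq_neg (e11 1 1)
    have dφ : M (Sum.inr 0) (Sum.inr 0) = (φ : ℂ) * Complex.I := eq_im_mul_I_of_star_eq_neg e22
    have d10 : M (Sum.inl 1) (Sum.inl 0) = -star m := by
      rw [hm, e11 1 0, neg_neg]
    -- the combination
    set Y : (uFormGroup (Fin 2) (Fin 1)).lie :=
      m.re • ⁅upqUnit ((0 : Fin 2), (0 : Fin 1)) (1 : ℂ), upqUnit ((1 : Fin 2), (0 : Fin 1)) 1⁆ +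
      m.im • ⁅upqUnit ((0 : Fin 2), (0 : Fin 1)) Complex.I, upqUnit ((1 : Fin 2), (0 : Fin 1)) 1⁆ +
      t₀ • ⁅upqUnit ((0 : Fin 2), (0 : Fin 1)) Complex.I, upqUnit ((0 : Fin 2), (0 : Fin 1)) 1⁆ +
      t₁ • ⁅upqUnit ((1 : Fin 2), (0 : Fin 1)) Complex.I, upqUnit ((1 : Fin 2), (0 : Fin 1)) 1⁆ +
      lam • upqZ0 (Fin 2) (Fin 1) with hY
    have hYS : Y ∈ S :=
      S.add_mem (S.add_mem (S.add_mem (S.add_mem (S.smul_mem _ (hbr 0 1 1 1)) (S.smul_mem _ (hbr 0 1 _ 1)))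
        (S.smul_mem _ (hbr 0 0 _ 1))) (S.smul_mem _ (hbr 1 1 _ 1))) (S.smul_mem _ hZ)
    have hkY : k = Y := by
      apply Subtype.ext
      rw [← hM, hY]
      simp only [AddMemClass.coe_add, SetLike.val_smul, hg, hd, coe_upqZ0, star_one, Complex.star_def,
        Complex.conj_I]
      ext i j
      rcases i with i | i <;> rcases j with j | j
      · -- the `𝔲(2)` block
        fin_cases i <;> fin_cases j
        · simp [d00, ht₀, hlam]
          ring
        · simpa using hm.symm
        · simp [d10]
          apply Complex.ext <;> simp
        · simp [d11, ht₁, hlam]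
          ring
      · fin_cases j
        simp [e12]
      · fin_cases i
        simp [e21]
      · fin_cases i; fin_cases j
        simp [dφ, ht₀, ht₁, hlam]
        ring
    rw [hkY]
    exact hYS
  -- `𝔤 = 𝔨 + Σ ℝ x_s`
  refine eq_top_iff.2 fun Z _ ↦ ?_
  obtain ⟨k, hk', c, rfl⟩ := upq_exists_kInLie_add_sum_upqPBasis Z
  refine S.add_mem (hk k hk') ?_
  exact S.toSubmodule.sum_mem fun s _ ↦ S.smul_mem (c s) (hP s)

/-! ## §4 For `U(2,1)`, skewness on the frame and on `z₀` gives skewness on all of `𝔤` -/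

/-- **Bracket closure**: for a `𝔤`-action `ρ𝔤` of `𝔲(2,1)` on `V` and any real bilinear form `B` on `V`, if `ρ𝔤(x_s)` is
`B`-skew for every vector `x_s` of the `𝔭`-frame and `ρ𝔤(z₀)` is `B`-skew, then `ρ𝔤(Y)` is `B`-skew for EVERY `Y ∈ 𝔲(2,1)`:
the `B`-skew elements form a Lie subalgebra (`ρ𝔤[X, Y] = ρ𝔤X ρ𝔤Y − ρ𝔤Y ρ𝔤X`, and a commutator of `B`-skew operators is
`B`-skew), which is everything by `upq21_lieSubalgebra_eq_top`. [cite: BorelWallach2000, Ch. 0 §2.5 (p. 4); II §1.1 (4)] -/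
theorem upq21_skew_of_frame {V : Type*} [AddCommGroup V] [Module ℂ V]
    (ρ𝔤 : (uFormGroup (Fin 2) (Fin 1)).lie →ₗ⁅ℝ⁆ Module.End ℂ V) (B : V →ₗ[ℝ] V →ₗ[ℝ] ℝ)
    (hP : ∀ (s : (Fin 2 × Fin 1) × Fin 2) (a b : V), B (ρ𝔤 (upqPBasis s) a) b = -B a (ρ𝔤 (upqPBasis s) b))
    (hZ : ∀ (a b : V), B (ρ𝔤 (upqZ0 (Fin 2) (Fin 1)) a) b = -B a (ρ𝔤 (upqZ0 (Fin 2) (Fin 1)) b))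
    (Y : (uFormGroup (Fin 2) (Fin 1)).lie) (a b : V) : B (ρ𝔤 Y a) b = -B a (ρ𝔤 Y b) := by
  let S : LieSubalgebra ℝ (uFormGroup (Fin 2) (Fin 1)).lie :=
    { carrier := {Y | ∀ a b : V, B (ρ𝔤 Y a) b = -B a (ρ𝔤 Y b)}
      add_mem' := by
        intro X Y hX hY
        simp only [Set.mem_setOf_eq] at hX hY ⊢
        intro a b
        simp only [map_add, LinearMap.add_apply, hX, hY]
        ring
      zero_mem' := by
        simp only [Set.mem_setOf_eq]
        intro a b
        simp only [map_zero, LinearMap.zero_apply, neg_zero]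
      smul_mem' := by
        intro r X hX
        simp only [Set.mem_setOf_eq] at hX ⊢
        intro a b
        have h1 : ρ𝔤 (r • X) = r • ρ𝔤 X := map_smul ρ𝔤 r X
        rw [h1, LinearMap.smul_apply, LinearMap.smul_apply, LinearMap.map_smul₂, map_smul, hX, smul_neg]
      lie_mem' := by
        intro X Y hX hY
        simp only [Set.mem_setOf_eq] at hX hY ⊢
        intro a b
        simp only [LieHom.map_lie, Ring.lie_def, LinearMap.sub_apply, Module.End.mul_apply, map_sub, hX, hY]
        ring }
  have hS : S = ⊤ := upq21_lieSubalgebra_eq_top S (fun s ↦ hP s) hZ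
  have hY : Y ∈ S := by
    rw [hS]
    exact LieSubalgebra.mem_top Y
  have hY' : ∀ a b : V, B (ρ𝔤 Y a) b = -B a (ρ𝔤 Y b) := hY
  exact hY' a b

/-! ## §5 The converse, the equivalence, and the line's sub-goal (α) -/

/-- **The six clauses imply Borel–Wallach unitarity for `U(2,1)`.**  For every `(𝔤, K)`-module `(ρK, ρ𝔤)` of `U(2,1)`:
if it is infinitesimally unitary along `𝔭 ⊕ ℝz₀` (★ `IsInfUnitaryAlongP`: a real symmetric positive-definite `B`, skew for
the `𝔭`-frame and `z₀`, `B(ia,b) = −B(a,ib)`), then it is unitary in the printed sense (★ `Liu2021.LemD2.IsInfUnitary`: a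
positive-definite Hermitian form with all of `𝔤` skew and `K` unitary).  Assembly of §1–§4: all of `𝔤` is `B`-skew
(`upq21_skew_of_frame`), hence `K = exp 𝔨` is `B`-orthogonal (`upq_bilin_apply_eq_of_skew`), and `H = B + iB(i·, ·)` is the
Hermitian form (`isInfUnitary_of_bilinForm`).  No admissibility or irreducibility is needed.
[cite: BorelWallach2000, Ch. 0 §2.5 (p. 4)] [cite: KnappVogan1995, §I.4 (1.64)–(1.65)] -/
theorem isInfUnitary_of_isInfUnitaryAlongP {V : Type*} [AddCommGroup V] [Module ℂ V]
    {ρK : Representation ℂ (uFormGroup (Fin 2) (Fin 1)).maximalCompact V}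
    {ρ𝔤 : (uFormGroup (Fin 2) (Fin 1)).lie →ₗ⁅ℝ⁆ Module.End ℂ V}
    (hGK : IsGKModule (uFormGroup (Fin 2) (Fin 1)) ρK ρ𝔤) (h : IsInfUnitaryAlongP ρ𝔤) :
    Liu2021.LemD2.IsInfUnitary ρK ρ𝔤 := by
  obtain ⟨B, hBs, hBp, hBd, hP, hZ, hBI⟩ := h
  have hskew : ∀ (Y : (uFormGroup (Fin 2) (Fin 1)).lie) (a b : V), B (ρ𝔤 Y a) b = -B a (ρ𝔤 Y b) :=
    upq21_skew_of_frame ρ𝔤 B hP hZ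
  have hK : ∀ (k : (uFormGroup (Fin 2) (Fin 1)).maximalCompact) (a b : V), B (ρK k a) (ρK k b) = B a b :=
    fun k a b ↦ upq_bilin_apply_eq_of_skew hGK B (fun X ↦ hskew _) k a b
  exact isInfUnitary_of_bilinForm ρK ρ𝔤 B hBs hBp hBd hBI hskew hK

/-- **For `U(2,1)` the six clauses are EQUIVALENT to Borel–Wallach unitarity** on every `(𝔤, K)`-module
(★ `isInfUnitaryAlongP_of_isInfUnitary` and `isInfUnitary_of_isInfUnitaryAlongP`). [cite: BorelWallach2000, Ch. 0 §2.5 (p. 4)] -/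
theorem isInfUnitary_iff_isInfUnitaryAlongP {V : Type*} [AddCommGroup V] [Module ℂ V]
    {ρK : Representation ℂ (uFormGroup (Fin 2) (Fin 1)).maximalCompact V}
    {ρ𝔤 : (uFormGroup (Fin 2) (Fin 1)).lie →ₗ⁅ℝ⁆ Module.End ℂ V}
    (hGK : IsGKModule (uFormGroup (Fin 2) (Fin 1)) ρK ρ𝔤) :
    Liu2021.LemD2.IsInfUnitary ρK ρ𝔤 ↔ IsInfUnitaryAlongP ρ𝔤 :=
  ⟨isInfUnitaryAlongP_of_isInfUnitary ρK ρ𝔤, isInfUnitary_of_isInfUnitaryAlongP hGK⟩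

/-- **Sub-goal (α) «six-clause bridge» of `stub_archAssembly`** (T1a arch line
`Cruxes/H413/Lines/F0_T1a_ArchCharactersLinIndep.lean`, consumed by name as the hypothesis `hα` of `archRealCase_of_package`):
for every irreducible `(𝔤, K)`-module `r` of `U(2,1)`, admissibility and infinitesimal unitarity along `𝔭 ⊕ ℝz₀` imply
unitarity in the printed sense (★ `Liu2021.LemD2.IsInfUnitary`).  By `isInfUnitary_of_isInfUnitaryAlongP` (with `r.isGKModule`);
the admissibility hypothesis is idle. [cite: BorelWallach2000, Ch. 0 §2.5 (p. 4)] -/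
theorem sixClauses_holds : ∀ r : GKIrrep (uFormGroup (Fin 2) (Fin 1)),
    IsAdmissibleGK r.ρK → r.IsInfUnitaryAlongP → Liu2021.LemD2.IsInfUnitary r.ρK r.ρ𝔤 :=
  fun r _ h ↦ isInfUnitary_of_isInfUnitaryAlongP r.isGKModule h

end Upq

end Literature.NumberTheory.Automorphic

end
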